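import Mathlib
import HarnessLib
import Summits.Ventures.LatticeQCDFlow.Exactness.SplittingWords
import Summits.Ventures.LatticeQCDFlow.Exactness.GaugeFTHMCLeapfrog

/-!
# FT-HMC with ANY palindromic splitting integrator — OMF2 and OMF4 included — is exact: the engine's three integrators, with the momentum refresh and the map, typed uniformly

HONEST FRAMING: exact (Metropolis-corrected) sampling algorithms for lattice gauge theory;
figures of merit are autocorrelation/cost numbers at stated couplings and volumes; no
continuum-physics claim.

Venture `LatticeQCDFlow` (cell pub-lqcd), topic `Exactness`; FANOUT row 14 (`eng-flowhmc`, engine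
`latflow.fthmc`: integrators `leapfrog` / `omf2` / `omf4` in velocity form, through the
pulled-back action, inside refresh → MD → flip → Metropolis → report).  NEW WORK of the cell,
assembling row 9's `SplittingWords` (`palindromicWord`, `omf2Word`, `omf4Word`, their flip
reversibility and Liouville: `palindromicWord_pow_isFlipReversible`,
`measurePreserving_palindromicWord`, `omf2_stages_*`, `omf4_stages_*` — row 9 typed HMC WITHOUT
refresh and map for these words), row 9's `SplittingIntegrator` (`mulDrift`), row 7's
`MomentumRefresh` (`thmc_config_exact`) and row 14's `GaugeFTHMCLeapfrog` (the U(1) rung data).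
Nothing is cited as a fact.  Printed counterparts, named only: Omelyan–Mryglod–Folk 2003,
Sexton–Weingarten 1992, Lüscher 2010 §2.

## Content

* `measurable_list_prod`, `measurable_flip_palindromicWord_pow_of_measurable` — measurability of
  `flip ∘ word^n` from measurability of the stages alone (no invariance instance needed, so the
  concrete U(1) statement below can be written without a local instance);
  `omf2Stages_measurable`, `measurable_flip_omf2Word_pow`;
* **`gauge_fthmc_palindromicWord_config_exact`** — gauge-link FT-HMC with ANY palindromic word
  `A₁ ⋯ A_k X A_k ⋯ A₁` of flip-reversible `μ ⊗ ν`-preserving stages: refresh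
  `π ∼ Z_T⁻¹e^{−T}ν` → `n` steps → flip → Metropolis on `H̃ = (S ∘ F − log J) + T` → forget →
  report through `F` leaves `e^{−S}·μ` invariant;
* **`gauge_fthmc_omf2_config_exact`** — the instance `omf2Word g₁ (mulDrift e) g₂` (kicks by ANY
  two measurable forces around the group drift by any measurable `e` with `e(−p) = e(p)⁻¹`);
  **`gauge_fthmc_omf4_config_exact`** — the instance `omf4Word` with three group drifts;
* **`u1_fthmc_omf2_gaussian_exact`** — the U(1) rung (product Haar links, Lebesgue momenta,
  `T = Σ p_i²/2`, link drift `V_i ← e^{i c p_i} V_i`): nothing left abstract but the member `F`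
  with its certified Jacobian.

NOT here: orders of accuracy; ergodicity; SU(N); any number.
-/

noncomputable section

namespace Summit.Ventures.LatticeQCDFlow.Exactness

open Set Function MeasureTheory Filter
open ProbabilityTheory ProbabilityTheory.Kernel
open Literature.MathematicalPhysics.QuantumFieldTheory (haarProbability)
open scoped NNReal ENNReal Topology

/-! ## Measurability of `flip ∘ word^n` from the stages -/

section Measurability

variable {Ω : Type*} [MeasurableSpace Ω]

/-- A product of measurable permutations is measurable. -/
theorem measurable_list_prod :
    ∀ L : List (Equiv.Perm Ω), (∀ A ∈ L, Measurable (⇑A)) → Measurable (⇑L.prod)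
  | [], _ => by
      rw [List.prod_nil, Equiv.Perm.coe_one]
      exact measurable_id
  | A :: L, hL => by
      rw [List.prod_cons, Equiv.Perm.coe_mul]
      exact (hL A List.mem_cons_self).comp
        (measurable_list_prod L fun B hB => hL B (List.mem_cons_of_mem _ hB))

variable {Q P : Type*} [MeasurableSpace Q] [MeasurableSpace P] [AddCommGroup P] [MeasurableNeg P]

/-- `flip ∘ (palindromic word)^n` is measurable as soon as the stages are. -/
theorem measurable_flip_palindromicWord_pow_of_measurable {L : List (Equiv.Perm (Q × P))}
    {X : Equiv.Perm (Q × P)} (hL : ∀ A ∈ L, Measurable (⇑A)) (hX : Measurable (⇑X)) (n : ℕ) :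
    Measurable (⇑((flip : Equiv.Perm (Q × P)) * palindromicWord L X ^ n)) := by
  rw [Equiv.Perm.coe_mul, Equiv.Perm.coe_pow]
  refine measurable_flip.comp (Measurable.iterate ?_ n)
  unfold palindromicWord
  rw [Equiv.Perm.coe_mul, Equiv.Perm.coe_mul]
  exact ((measurable_list_prod L hL).comp hX).comp
    (measurable_list_prod L.reverse fun A hA => hL A (List.mem_reverse.1 hA))

variable [Group Q] [MeasurableMul₂ Q] [MeasurableAdd₂ P]

omit [MeasurableNeg P] in
/-- The outer stages `[K_{g₁}, D_e]` of the OMF2 word with a group drift are measurable. -/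
theorem omf2Stages_measurable {e : P → Q} (hem : Measurable e) {g₁ : Q → P}
    (hg₁ : Measurable g₁) :
    ∀ A ∈ [kick g₁, drift (mulDrift e)], Measurable (⇑A) := by
  intro A hA
  simp only [List.mem_cons, List.mem_nil_iff, or_false] at hA
  rcases hA with rfl | rfl
  · exact measurable_kick hg₁
  · exact measurable_drift (measurable_mulDrift hem)

/-- `flip ∘ (OMF2 word)^n` with a group drift is measurable. -/
theorem measurable_flip_omf2Word_pow {e : P → Q} (hem : Measurable e) {g₁ g₂ : Q → P}
    (hg₁ : Measurable g₁) (hg₂ : Measurable g₂) (n : ℕ) :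
    Measurable (⇑((flip : Equiv.Perm (Q × P)) * omf2Word g₁ (mulDrift e) g₂ ^ n)) :=
  measurable_flip_palindromicWord_pow_of_measurable (omf2Stages_measurable hem hg₁)
    (measurable_kick hg₂) n

end Measurability

/-! ## Gauge-link FT-HMC with any palindromic word -/

section Gauge

variable {Q P : Type*}

/-- **Gauge-link FT-HMC with ANY palindromic splitting integrator is exact.**  Links in a
measurable space `Q` with s-finite `μ`; momenta in an additive group `P` with reflection-invariant
s-finite `ν`; kinetic term `T` with `0 < Z_T < ∞`; field transformation `F : Q ≃ᵐ Q` with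
positive measurable Jacobian `J`; stages `A ∈ L` and centre `X`, each flip-reversible and
`μ ⊗ ν`-preserving (kicks by any measurable force, group drifts by any measurable `e` with the
reversal law, at any coefficients).  Refresh `π ∼ Z_T⁻¹e^{−T}ν` → `n` steps of
`A₁ ⋯ A_k X A_k ⋯ A₁` → flip → accept on `ΔH̃`, `H̃ = (S ∘ F − log J) + T` → forget → report
`U = F V`: the configuration kernel leaves `e^{−S}·μ` invariant. -/
theorem gauge_fthmc_palindromicWord_config_exact [MeasurableSpace Q] {μ : Measure Q} [SFinite μ]
    [AddCommGroup P] [MeasurableSpace P] [MeasurableNeg P] {ν : Measure P} [ν.IsNegInvariant]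
    [SFinite ν] {F : Q ≃ᵐ Q} {J : Q → ℝ} (hJ : ∀ v, 0 < J v) (hJm : Measurable J)
    (hF : HasJacobian μ F fun v => ENNReal.ofReal (J v))
    {L : List (Equiv.Perm (Q × P))} {X : Equiv.Perm (Q × P)}
    (hX : IsFlipReversible flip X) (hXm : MeasurePreserving (⇑X) (μ.prod ν) (μ.prod ν))
    (hL : ∀ A ∈ L, IsFlipReversible flip A)
    (hLm : ∀ A ∈ L, MeasurePreserving (⇑A) (μ.prod ν) (μ.prod ν)) (n : ℕ)
    {S : Q → ℝ} (hS : Measurable S) {T : P → ℝ} (hT : Measurable T)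
    (hZ0 : ν.withDensity (fun q => ENNReal.ofReal (Real.exp (-T q))) Set.univ ≠ 0)
    (hZtop : ν.withDensity (fun q => ENNReal.ofReal (Real.exp (-T q))) Set.univ ≠ ∞) :
    Invariant
      (conjKernel
        (refreshUpdate
          (involMH (⇑((flip : Equiv.Perm (Q × P)) * palindromicWord L X ^ n))
            (measurable_flip_palindromicWord_pow measurePreserving_flip hXm hLm n)
            fun z : Q × P => (S (F z.1) - Real.log (J z.1)) + T z.2)
          ((ν.withDensity (fun q => ENNReal.ofReal (Real.exp (-T q))) Set.univ)⁻¹ •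
            ν.withDensity fun q => ENNReal.ofReal (Real.exp (-T q))))
        F)
      (μ.withDensity fun u => ENNReal.ofReal (Real.exp (-S u))) := by
  refine thmc_config_exact hJ hJm hF hS hT
    (palindromicWord_pow_isFlipReversible flip_mul_flip hX hL n).involutive ?_ hZ0 hZtop
  rw [Equiv.Perm.coe_mul]
  exact measurePreserving_flip.comp
    (measurePreserving_perm_pow (measurePreserving_palindromicWord hXm hLm) n)

/-- **OMF2 (velocity form) inside gauge-link FT-HMC is exact**: the word
`K_{g₁} D_e K_{g₂} D_e K_{g₁} = omf2Word g₁ (mulDrift e) g₂` — kicks by ANY two measurable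
forces (in the code `λh` and `(1−2λ)h` times the force of `S̃`) around the group drift by any
measurable `e` with `e(−p) = e(p)⁻¹` (in the code `p ↦ exp(h p/2)`), `n` steps, flip,
Metropolis on `ΔH̃`, inside refresh / forget / report. -/
theorem gauge_fthmc_omf2_config_exact [Group Q] [MeasurableSpace Q] [MeasurableMul₂ Q]
    {μ : Measure Q} [μ.IsMulLeftInvariant] [SFinite μ] [AddCommGroup P] [MeasurableSpace P]
    [MeasurableNeg P] [MeasurableAdd₂ P] {ν : Measure P} [ν.IsNegInvariant]
    [ν.IsAddRightInvariant] [SFinite ν] {F : Q ≃ᵐ Q} {J : Q → ℝ} (hJ : ∀ v, 0 < J v)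
    (hJm : Measurable J) (hF : HasJacobian μ F fun v => ENNReal.ofReal (J v))
    {e : P → Q} (he : ∀ p, e (-p) = (e p)⁻¹) (hem : Measurable e) {g₁ g₂ : Q → P}
    (hg₁ : Measurable g₁) (hg₂ : Measurable g₂) (n : ℕ) {S : Q → ℝ} (hS : Measurable S)
    {T : P → ℝ} (hT : Measurable T)
    (hZ0 : ν.withDensity (fun q => ENNReal.ofReal (Real.exp (-T q))) Set.univ ≠ 0)
    (hZtop : ν.withDensity (fun q => ENNReal.ofReal (Real.exp (-T q))) Set.univ ≠ ∞) :
    Invariant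
      (conjKernel
        (refreshUpdate
          (involMH (⇑((flip : Equiv.Perm (Q × P)) * omf2Word g₁ (mulDrift e) g₂ ^ n))
            (measurable_flip_omf2Word_pow hem hg₁ hg₂ n)
            fun z : Q × P => (S (F z.1) - Real.log (J z.1)) + T z.2)
          ((ν.withDensity (fun q => ENNReal.ofReal (Real.exp (-T q))) Set.univ)⁻¹ •
            ν.withDensity fun q => ENNReal.ofReal (Real.exp (-T q))))
        F)
      (μ.withDensity fun u => ENNReal.ofReal (Real.exp (-S u))) :=
  gauge_fthmc_palindromicWord_config_exact hJ hJm hF (kick_isFlipReversible g₂)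
    (measurePreserving_kick hg₂) (omf2_stages_isFlipReversible (mulDrift_reversal he))
    (omf2_stages_measurePreserving (measurable_mulDrift hem) (measurePreserving_mulDrift e) hg₁)
    n hS hT hZ0 hZtop

/-- **OMF4 inside gauge-link FT-HMC is exact**: the 11-stage word
`omf4Word gᵥ (mulDrift e₁) gₗ (mulDrift e₂) g_c (mulDrift e₃)` — kicks by ANY three measurable
forces, group drifts by ANY three measurable `eᵢ` with the reversal law (in the code the
Omelyan–Mryglod–Folk coefficients times the force of `S̃`, resp. times `p`), `n` steps, flip,
Metropolis on `ΔH̃`, inside refresh / forget / report. -/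
theorem gauge_fthmc_omf4_config_exact [Group Q] [MeasurableSpace Q] [MeasurableMul₂ Q]
    {μ : Measure Q} [μ.IsMulLeftInvariant] [SFinite μ] [AddCommGroup P] [MeasurableSpace P]
    [MeasurableNeg P] [MeasurableAdd₂ P] {ν : Measure P} [ν.IsNegInvariant]
    [ν.IsAddRightInvariant] [SFinite ν] {F : Q ≃ᵐ Q} {J : Q → ℝ} (hJ : ∀ v, 0 < J v)
    (hJm : Measurable J) (hF : HasJacobian μ F fun v => ENNReal.ofReal (J v))
    {e₁ e₂ e₃ : P → Q} (he₁ : ∀ p, e₁ (-p) = (e₁ p)⁻¹) (he₂ : ∀ p, e₂ (-p) = (e₂ p)⁻¹)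
    (he₃ : ∀ p, e₃ (-p) = (e₃ p)⁻¹) (hem₁ : Measurable e₁) (hem₂ : Measurable e₂)
    (hem₃ : Measurable e₃) {gᵥ gₗ g_c : Q → P} (hgᵥ : Measurable gᵥ) (hgₗ : Measurable gₗ)
    (hg_c : Measurable g_c) (n : ℕ) {S : Q → ℝ} (hS : Measurable S) {T : P → ℝ}
    (hT : Measurable T)
    (hZ0 : ν.withDensity (fun q => ENNReal.ofReal (Real.exp (-T q))) Set.univ ≠ 0)
    (hZtop : ν.withDensity (fun q => ENNReal.ofReal (Real.exp (-T q))) Set.univ ≠ ∞) :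
    Invariant
      (conjKernel
        (refreshUpdate
          (involMH
            (⇑((flip : Equiv.Perm (Q × P)) *
                omf4Word gᵥ (mulDrift e₁) gₗ (mulDrift e₂) g_c (mulDrift e₃) ^ n))
            (measurable_flip_palindromicWord_pow (vol := μ.prod ν) measurePreserving_flip
              (measurePreserving_drift (measurable_mulDrift hem₃) (measurePreserving_mulDrift e₃))
              (omf4_stages_measurePreserving (measurable_mulDrift hem₁)
                (measurePreserving_mulDrift e₁) (measurable_mulDrift hem₂)
                (measurePreserving_mulDrift e₂) hgᵥ hgₗ hg_c) n)
            fun z : Q × P => (S (F z.1) - Real.log (J z.1)) + T z.2)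
          ((ν.withDensity (fun q => ENNReal.ofReal (Real.exp (-T q))) Set.univ)⁻¹ •
            ν.withDensity fun q => ENNReal.ofReal (Real.exp (-T q))))
        F)
      (μ.withDensity fun u => ENNReal.ofReal (Real.exp (-S u))) :=
  gauge_fthmc_palindromicWord_config_exact hJ hJm hF
    (drift_isFlipReversible (mulDrift_reversal he₃))
    (measurePreserving_drift (measurable_mulDrift hem₃) (measurePreserving_mulDrift e₃))
    (omf4_stages_isFlipReversible (mulDrift_reversal he₁) (mulDrift_reversal he₂))
    (omf4_stages_measurePreserving (measurable_mulDrift hem₁) (measurePreserving_mulDrift e₁)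
      (measurable_mulDrift hem₂) (measurePreserving_mulDrift e₂) hgᵥ hgₗ hg_c)
    n hS hT hZ0 hZtop

end Gauge

/-! ## The U(1) rung with the OMF2 word -/

section U1

variable {ι : Type*} [Fintype ι]

/-- **FT-HMC on the U(1) rung with the engine's OMF2 integrator and Gaussian momenta is exact.**
Links `ι → U(1)` (product Haar probability), momenta `ι → ℝ` (Lebesgue, `T = Σ p_i²/2`), member
`F` with certified positive Jacobian, drift `V_i ← e^{i c p_i} V_i`, kicks by ANY two measurable
forces, `n` steps: the reported configuration kernel leaves `e^{−S}·Haar^ι` invariant. -/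
theorem u1_fthmc_omf2_gaussian_exact
    {F : (ι → Circle) ≃ᵐ (ι → Circle)} {J : (ι → Circle) → ℝ} (hJ : ∀ V, 0 < J V)
    (hJm : Measurable J)
    (hF : HasJacobian (Measure.pi fun _ : ι => haarProbability Circle) F
      fun V => ENNReal.ofReal (J V))
    {S : (ι → Circle) → ℝ} (hS : Measurable S) (c : ℝ) {g₁ g₂ : (ι → Circle) → (ι → ℝ)}
    (hg₁ : Measurable g₁) (hg₂ : Measurable g₂) (n : ℕ) :
    Invariant
      (conjKernel
        (refreshUpdate
          (involMH
            (⇑((flip : Equiv.Perm ((ι → Circle) × (ι → ℝ))) *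
                omf2Word g₁ (mulDrift fun p : ι → ℝ => fun i => Circle.exp (c * p i)) g₂ ^ n))
            (measurable_flip_omf2Word_pow (measurable_circleDrift c) hg₁ hg₂ n)
            fun z : (ι → Circle) × (ι → ℝ) => (S (F z.1) - Real.log (J z.1)) + ∑ i, z.2 i ^ 2 / 2)
          ((((volume : Measure (ι → ℝ)).withDensity
                fun q => ENNReal.ofReal (Real.exp (-(∑ i, q i ^ 2 / 2)))) Set.univ)⁻¹ •
            (volume : Measure (ι → ℝ)).withDensity
              fun q => ENNReal.ofReal (Real.exp (-(∑ i, q i ^ 2 / 2)))))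
        F)
      ((Measure.pi fun _ : ι => haarProbability Circle).withDensity
        fun U => ENNReal.ofReal (Real.exp (-S U))) := by
  haveI := isNegInvariant_volume_pi (Λ := ι)
  exact gauge_fthmc_omf2_config_exact (μ := Measure.pi fun _ : ι => haarProbability Circle)
    (ν := (volume : Measure (ι → ℝ))) (F := F) (J := J)
    (e := fun p : ι → ℝ => fun i => Circle.exp (c * p i)) (g₁ := g₁) (g₂ := g₂) (S := S)
    (T := fun p : ι → ℝ => ∑ i, p i ^ 2 / 2) hJ hJm hF (fun p => circleDrift_neg c p)
    (measurable_circleDrift c) hg₁ hg₂ n hS measurable_piGaussianKinetic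
    piGaussianWeight_univ_ne_zero_ne_top.1 piGaussianWeight_univ_ne_zero_ne_top.2

end U1

end Summit.Ventures.LatticeQCDFlow.Exactness
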